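import Summits.CriticalPhenomena.Ising3DConformalLimit.Theses.FKParityRobustness
import Literature.Probability.Percolation.SiteConnectionTools
import Literature.Probability.LatticeModels.LatticeGraph
import Literature.Probability.LatticeModels.ThermodynamicLimit
import HarnessLib

/-!
# Crux IndependentStrandsJoin (stmt-CriticalPhenomena-14625), line Sketch — stub `stub_boxSymmetry`

Route `FKParityRobustness`, sub-problem `Ising3DConformalLimit`; Stub 5 of the skeleton of the line
`Sketch` (the tetrahedral sandwich): **the boxes `Λ_N = {-N,…,N}³ ⊂ ℤ³` with the marked quadruple
`a = l · tetra`, `tetra = ((−1,−1,−1), (1,1,−1), (1,−1,1), (−1,1,1))`, have the pairing symmetry.**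
With `G_N = (zdGraph 3).comap Subtype.val` the nearest-neighbour graph induced on `↥(box 3 N)`, there
are automorphisms `φ, ψ : G_N ≃g G_N` with

* `φ a₀ = a₀`, `φ a₁ = a₂`, `φ a₂ = a₁`, `φ a₃ = a₃` (transposition `(a₁ a₂)`),
* `ψ a₀ = a₀`, `ψ a₁ = a₃`, `ψ a₃ = a₁`, `ψ a₂ = a₂` (transposition `(a₁ a₃)`).

**Proof.** A coordinate permutation `π ∈ S₃` acts on `ℤ³` by the graph automorphism
`zdSignedPermIso π 1` (`x ↦ (i ↦ x (π⁻¹ i))`, `SiteConnectionTools.lean`), which preserves every box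
`Λ_N` (`signedPerm_mem_box_iff`); restricting along `Equiv.subtypeEquiv` gives an automorphism of the
induced box graph acting by the same formula on coordinates (`StubBoxSymmetry.exists_boxIso`).
Take `φ` from `π = (y z) = Equiv.swap 1 2`: it fixes `l(−1,−1,−1) = a₀` and `l(−1,1,1) = a₃` and
exchanges `l(1,1,−1) = a₁` with `l(1,−1,1) = a₂`; take `ψ` from `π = (x z) = Equiv.swap 0 2`: it fixes
`a₀` and `a₂ = l(1,−1,1)` and exchanges `a₁ = l(1,1,−1)` with `a₃ = l(−1,1,1)` — a coordinate check
(`fin_cases`). The degenerate `l = 0` (all four points at the origin) is covered by the same maps.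

Sources: folklore (hyperoctahedral symmetries of `ℤ^d`; G. Grimmett, *Percolation*, 2nd ed.,
Springer 1999, §1.6); tree API `Literature/Probability/Percolation/SiteConnectionTools.lean`
(`zdSignedPermIso`, `Site.signedPerm_apply`, `signedPerm_mem_box_iff`).
-/

noncomputable section

open Finset SimpleGraph
open Literature.Probability.LatticeModels
open Summit.CriticalPhenomena.Ising3DConformalLimit.Theses.FKParityRobustness
open scoped Classical BigOperators

namespace Summit.CriticalPhenomena.Ising3DConformalLimit.Theorems

namespace StubBoxSymmetry

open Literature.Probability.Percolation (zdSignedPermIso zdSignedPermIso_apply signedPerm_mem_box_iff)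

/-- Restriction of the coordinate-permutation automorphism `zdSignedPermIso π 1` of `ℤ³` to the box
`Λ_N`: an automorphism of the induced box graph `(zdGraph 3).comap Subtype.val` on `↥(box 3 N)` acting
on coordinates by `Site.signedPerm π 1`, i.e. `x ↦ (i ↦ x (π⁻¹ i))`. [folklore] -/
theorem exists_boxIso (N : ℕ) (π : Equiv.Perm (Fin 3)) :
    ∃ Φ : ((zdGraph 3).comap (Subtype.val : ↥(box 3 N) → Site 3)) ≃g
        ((zdGraph 3).comap (Subtype.val : ↥(box 3 N) → Site 3)),
      ∀ x : ↥(box 3 N), ((Φ x : ↥(box 3 N)) : Site 3) = Site.signedPerm π (fun _ => 1) (x : Site 3) :=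
  ⟨{ toEquiv := (Site.signedPerm π (fun _ => 1)).subtypeEquiv
        (fun _ => (signedPerm_mem_box_iff π (fun _ => 1)).symm)
     map_rel_iff' := by
       intro x y
       simp only [SimpleGraph.comap_adj, Equiv.subtypeEquiv_apply]
       exact (zdSignedPermIso π (fun _ => 1)).map_rel_iff' },
    fun _ => rfl⟩

/-- Coordinate check for `π = (y z)`: `Site.signedPerm (Equiv.swap 1 2) 1` fixes `l(−1,−1,−1)` and
`l(−1,1,1)` and exchanges `l(1,1,−1)` with `l(1,−1,1)`. [folklore] -/
theorem signedPerm_swap12_tetra (l : ℕ) :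
    Site.signedPerm (Equiv.swap 1 2) (fun _ => 1)
        ((l : ℤ) • (![![-1, -1, -1], ![1, 1, -1], ![1, -1, 1], ![-1, 1, 1]] : Fin 4 → Site 3) 0) =
      (l : ℤ) • (![![-1, -1, -1], ![1, 1, -1], ![1, -1, 1], ![-1, 1, 1]] : Fin 4 → Site 3) 0 ∧
    Site.signedPerm (Equiv.swap 1 2) (fun _ => 1)
        ((l : ℤ) • (![![-1, -1, -1], ![1, 1, -1], ![1, -1, 1], ![-1, 1, 1]] : Fin 4 → Site 3) 1) =
      (l : ℤ) • (![![-1, -1, -1], ![1, 1, -1], ![1, -1, 1], ![-1, 1, 1]] : Fin 4 → Site 3) 2 ∧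
    Site.signedPerm (Equiv.swap 1 2) (fun _ => 1)
        ((l : ℤ) • (![![-1, -1, -1], ![1, 1, -1], ![1, -1, 1], ![-1, 1, 1]] : Fin 4 → Site 3) 2) =
      (l : ℤ) • (![![-1, -1, -1], ![1, 1, -1], ![1, -1, 1], ![-1, 1, 1]] : Fin 4 → Site 3) 1 ∧
    Site.signedPerm (Equiv.swap 1 2) (fun _ => 1)
        ((l : ℤ) • (![![-1, -1, -1], ![1, 1, -1], ![1, -1, 1], ![-1, 1, 1]] : Fin 4 → Site 3) 3) =
      (l : ℤ) • (![![-1, -1, -1], ![1, 1, -1], ![1, -1, 1], ![-1, 1, 1]] : Fin 4 → Site 3) 3 := by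
  refine ⟨?_, ?_, ?_, ?_⟩ <;> funext j <;> fin_cases j <;> simp [Equiv.swap_apply_def]

/-- Coordinate check for `π = (x z)`: `Site.signedPerm (Equiv.swap 0 2) 1` fixes `l(−1,−1,−1)` and
`l(1,−1,1)` and exchanges `l(1,1,−1)` with `l(−1,1,1)`. [folklore] -/
theorem signedPerm_swap02_tetra (l : ℕ) :
    Site.signedPerm (Equiv.swap 0 2) (fun _ => 1)
        ((l : ℤ) • (![![-1, -1, -1], ![1, 1, -1], ![1, -1, 1], ![-1, 1, 1]] : Fin 4 → Site 3) 0) =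
      (l : ℤ) • (![![-1, -1, -1], ![1, 1, -1], ![1, -1, 1], ![-1, 1, 1]] : Fin 4 → Site 3) 0 ∧
    Site.signedPerm (Equiv.swap 0 2) (fun _ => 1)
        ((l : ℤ) • (![![-1, -1, -1], ![1, 1, -1], ![1, -1, 1], ![-1, 1, 1]] : Fin 4 → Site 3) 1) =
      (l : ℤ) • (![![-1, -1, -1], ![1, 1, -1], ![1, -1, 1], ![-1, 1, 1]] : Fin 4 → Site 3) 3 ∧
    Site.signedPerm (Equiv.swap 0 2) (fun _ => 1)
        ((l : ℤ) • (![![-1, -1, -1], ![1, 1, -1], ![1, -1, 1], ![-1, 1, 1]] : Fin 4 → Site 3) 3) =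
      (l : ℤ) • (![![-1, -1, -1], ![1, 1, -1], ![1, -1, 1], ![-1, 1, 1]] : Fin 4 → Site 3) 1 ∧
    Site.signedPerm (Equiv.swap 0 2) (fun _ => 1)
        ((l : ℤ) • (![![-1, -1, -1], ![1, 1, -1], ![1, -1, 1], ![-1, 1, 1]] : Fin 4 → Site 3) 2) =
      (l : ℤ) • (![![-1, -1, -1], ![1, 1, -1], ![1, -1, 1], ![-1, 1, 1]] : Fin 4 → Site 3) 2 := by
  refine ⟨?_, ?_, ?_, ?_⟩ <;> funext j <;> fin_cases j <;> simp [Equiv.swap_apply_def]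

end StubBoxSymmetry

/-- **Stub 5 (box pairing symmetry).**  For `a = l · tetra` in the box `Λ_N = {-N,…,N}³` with its
induced nearest-neighbour graph, the coordinate transpositions `y ↔ z` and `x ↔ z` (restricted
`zdSignedPermIso`, `signedPerm_mem_box_iff`) are graph automorphisms fixing `a₀ = l(−1,−1,−1)` and
realising `(a₁ a₂)`, resp. `(a₁ a₃)`. [folklore] -/
theorem stub_boxSymmetry :
    ∀ (l N : ℕ) (a : Fin 4 → ↥(box 3 N)),
      (∀ i, ((a i : Site 3)) = (l : ℤ) •
        (![![-1, -1, -1], ![1, 1, -1], ![1, -1, 1], ![-1, 1, 1]] : Fin 4 → Site 3) i) →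
      (∃ φ : ((zdGraph 3).comap (Subtype.val : ↥(box 3 N) → Site 3)) ≃g
          ((zdGraph 3).comap (Subtype.val : ↥(box 3 N) → Site 3)),
          φ (a 0) = a 0 ∧ φ (a 1) = a 2 ∧ φ (a 2) = a 1 ∧ φ (a 3) = a 3) ∧
      (∃ ψ : ((zdGraph 3).comap (Subtype.val : ↥(box 3 N) → Site 3)) ≃g
          ((zdGraph 3).comap (Subtype.val : ↥(box 3 N) → Site 3)),
          ψ (a 0) = a 0 ∧ ψ (a 1) = a 3 ∧ ψ (a 3) = a 1 ∧ ψ (a 2) = a 2) := by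
  intro l N a ha
  obtain ⟨φ, hφ⟩ := StubBoxSymmetry.exists_boxIso N (Equiv.swap 1 2)
  obtain ⟨ψ, hψ⟩ := StubBoxSymmetry.exists_boxIso N (Equiv.swap 0 2)
  obtain ⟨h0, h1, h2, h3⟩ := StubBoxSymmetry.signedPerm_swap12_tetra l
  obtain ⟨k0, k1, k3, k2⟩ := StubBoxSymmetry.signedPerm_swap02_tetra l
  refine ⟨⟨φ, ?_, ?_, ?_, ?_⟩, ⟨ψ, ?_, ?_, ?_, ?_⟩⟩
  · exact Subtype.ext (by rw [hφ, ha 0, h0])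
  · exact Subtype.ext (by rw [hφ, ha 1, ha 2, h1])
  · exact Subtype.ext (by rw [hφ, ha 2, ha 1, h2])
  · exact Subtype.ext (by rw [hφ, ha 3, h3])
  · exact Subtype.ext (by rw [hψ, ha 0, k0])
  · exact Subtype.ext (by rw [hψ, ha 1, ha 3, k1])
  · exact Subtype.ext (by rw [hψ, ha 3, ha 1, k3])
  · exact Subtype.ext (by rw [hψ, ha 2, k2])

end Summit.CriticalPhenomena.Ising3DConformalLimit.Theorems
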